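import Mathlib
import Literature.NumberTheory.Transcendental.KZRayDilog
import Literature.NumberTheory.Transcendental.KZIdealTetrahedron
import Literature.NumberTheory.Transcendental.KZCalculusProofs
import Literature.NumberTheory.Transcendental.KZDominatedFamilyRelations
import Literature.NumberTheory.Transcendental.KZLogCalculusProofs
import Literature.NumberTheory.Transcendental.SemialgebraicMapsProofs
import Literature.NumberTheory.Transcendental.KZSemialgebraicComplex

/-!
# `OffTetraSectorKernel`, line `flat-shadow`: the log-cell algebra (rules 1a/1b)

Stub `stub_cellAlgebra` of the crux `OffTetraSectorKernel` (stmt-KontsevichZagierPeriods-10557, route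
HyperbolicBloch), a station of the Milnor bridge. Coordinates `w 0 = s`, `w 1 = v`; `z = a + ib` algebraic,
`b > 0`, `N = |z|²`, `c = N − 2a`, `M = N s(1−s)`, `L = (1−s)/s`, `U = 1 + cs`, `f = b/(2 Q(s) v)`,
`Q(s) = (1 − sa)² + (sb)² = U − M > 0`. For `V = [{M < v < U}, f]`, the scaled ray representation
`R = [{v between M and L}, sgn(L − v)·f]` and `C = [{v between L and U}, sgn(U − v)·f]`:
`[V] − [R] − [C] ∈ KZ.relations`, and a `C`-representation exists. Proof: the pairwise disjoint open cells
`P₁ = {M < v < min(L,U)}`, `P₂ = {max(M,L) < v < U}`, `P₃ = {U < v < L}`, `P₄ = {L < v < M}` almost-partition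
the three domains (`V = P₁ ⊔ P₂`, `R = P₁ ⊔ P₃ ⊔ P₄` with signs `+,+,−`, `C = P₂ ⊔ P₄ ⊔ P₃` with signs
`+,+,−`, up to the null graphs `v = L, U, M`), so `[V] − [R] − [C] ≡ (P₁+P₂) − (P₁+P₃−P₄) − (P₂+P₄−P₃) = 0`
by domain additivity and integrand congruence. References: M. Kontsevich, D. Zagier, *Periods* (2001),
§1.2 rule (1); D. Zagier, *The dilogarithm function* (2007), Ch. I §3.
-/

noncomputable section

open Set MeasureTheory MvPolynomial
open Literature.NumberTheory.Transcendental Literature.ModelTheory.ExponentialFields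

namespace Summit.KontsevichZagierPeriods.HyperbolicBloch.OffTetraSectorKernel

variable {z : ℂ}

/-- The eight basic regions `{0 < s}`, `{s < 1}`, `{v s < 1 − s}`, `{1 − s < v s}`, `{M < v}`, `{v < M}`,
`{v < U}`, `{U < v}` are `ℚ`-semialgebraic (strict inequalities between `ℚ`-semialgebraic functions with
real-algebraic coefficients). [cite: BochnakCosteRoy1998, Prop. 2.2.6] -/
theorem cellAlg_sa_basic (hz : IsAlgebraic ℚ z) :
    IsSemialgebraic ℚ {w : Fin 2 → ℝ | 0 < w 0} ∧ IsSemialgebraic ℚ {w : Fin 2 → ℝ | w 0 < 1} ∧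
    IsSemialgebraic ℚ {w : Fin 2 → ℝ | w 1 * w 0 < 1 - w 0} ∧
    IsSemialgebraic ℚ {w : Fin 2 → ℝ | 1 - w 0 < w 1 * w 0} ∧
    IsSemialgebraic ℚ {w : Fin 2 → ℝ | Complex.normSq z * w 0 * (1 - w 0) < w 1} ∧
    IsSemialgebraic ℚ {w : Fin 2 → ℝ | w 1 < Complex.normSq z * w 0 * (1 - w 0)} ∧
    IsSemialgebraic ℚ {w : Fin 2 → ℝ | w 1 < 1 + (Complex.normSq z - 2 * z.re) * w 0} ∧
    IsSemialgebraic ℚ {w : Fin 2 → ℝ | 1 + (Complex.normSq z - 2 * z.re) * w 0 < w 1} := by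
  obtain ⟨hre, him⟩ := isAlgebraic_re_im hz
  have hU : IsSemialgebraic ℚ (univ : Set (Fin 2 → ℝ)) := isSemialgebraic_univ
  have hN : IsAlgebraic ℚ (Complex.normSq z) := by
    rw [Complex.normSq_apply]; exact (hre.mul hre).add (him.mul him)
  have hc : IsAlgebraic ℚ (Complex.normSq z - 2 * z.re) := by
    rw [two_mul]; exact hN.sub (hre.add hre)
  have h0 : IsSemialgebraicFunOn ℚ (univ : Set (Fin 2 → ℝ)) (fun w => w 0) :=
    (isSemialgebraicFunOn_aeval hU (X 0)).congr fun w _ => by simp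
  have h1 : IsSemialgebraicFunOn ℚ (univ : Set (Fin 2 → ℝ)) (fun w => w 1) :=
    (isSemialgebraicFunOn_aeval hU (X 1)).congr fun w _ => by simp
  have hone : IsSemialgebraicFunOn ℚ (univ : Set (Fin 2 → ℝ)) (fun _ => (1 : ℝ)) := by
    simpa using isSemialgebraicFunOn_natCast (k := ℚ) (R := ℝ) hU 1
  have hzero : IsSemialgebraicFunOn ℚ (univ : Set (Fin 2 → ℝ)) (fun _ => (0 : ℝ)) := by
    simpa using isSemialgebraicFunOn_natCast (k := ℚ) (R := ℝ) hU 0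
  have hsub : IsSemialgebraicFunOn ℚ (univ : Set (Fin 2 → ℝ)) (fun w => 1 - w 0) :=
    IsSemialgebraicFunOn.sub_holds hone h0
  have hM : IsSemialgebraicFunOn ℚ (univ : Set (Fin 2 → ℝ)) (fun w => Complex.normSq z * w 0 * (1 - w 0)) :=
    IsSemialgebraicFunOn.mul_holds (IsSemialgebraicFunOn.mul_holds
      (isSemialgebraicFunOn_const_of_isAlgebraic hU hN) h0) hsub
  have hUU : IsSemialgebraicFunOn ℚ (univ : Set (Fin 2 → ℝ))
      (fun w => 1 + (Complex.normSq z - 2 * z.re) * w 0) :=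
    IsSemialgebraicFunOn.add_holds hone (IsSemialgebraicFunOn.mul_holds
      (isSemialgebraicFunOn_const_of_isAlgebraic hU hc) h0)
  have hvs : IsSemialgebraicFunOn ℚ (univ : Set (Fin 2 → ℝ)) (fun w => w 1 * w 0) :=
    IsSemialgebraicFunOn.mul_holds h1 h0
  exact ⟨isSemialgebraic_setOf_lt_of_isSemialgebraicFunOn hzero h0,
    isSemialgebraic_setOf_lt_of_isSemialgebraicFunOn h0 hone,
    isSemialgebraic_setOf_lt_of_isSemialgebraicFunOn hvs hsub,
    isSemialgebraic_setOf_lt_of_isSemialgebraicFunOn hsub hvs,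
    isSemialgebraic_setOf_lt_of_isSemialgebraicFunOn hM h1,
    isSemialgebraic_setOf_lt_of_isSemialgebraicFunOn h1 hM,
    isSemialgebraic_setOf_lt_of_isSemialgebraicFunOn h1 hUU,
    isSemialgebraic_setOf_lt_of_isSemialgebraicFunOn hUU h1⟩

/-- The graph `{v s = 1 − s, s > 0}` of `L(s) = (1−s)/s` is null. [folklore] -/
theorem cellAlg_null_L : volume {w : Fin 2 → ℝ | 0 < w 0 ∧ w 1 * w 0 = 1 - w 0} = 0 := by
  have hσ : IsSemialgebraic ℚ {x : Fin 1 → ℝ | 0 < x 0} := by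
    simpa using isSemialgebraic_setOf_eval_pos (k := ℚ) (R := ℝ) (X 0 : MvPolynomial (Fin 1) ℚ)
  have hx : IsSemialgebraicFunOn ℚ {x : Fin 1 → ℝ | 0 < x 0} (fun x => x 0) :=
    (isSemialgebraicFunOn_aeval hσ (X 0)).congr fun w _ => by simp
  have h1 : IsSemialgebraicFunOn ℚ {x : Fin 1 → ℝ | 0 < x 0} (fun x => 1 - x 0) :=
    (isSemialgebraicFunOn_aeval hσ (1 - X 0)).congr fun w _ => by simp
  have hu : IsSemialgebraicFunOn ℚ {x : Fin 1 → ℝ | 0 < x 0} (fun x => (1 - x 0) / x 0) :=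
    (IsSemialgebraicFunOn.div h1 hx fun x hx => (ne_of_gt hx)).congr fun w _ => by simp
  refine measure_mono_null (fun w hw => ?_) (KZ.volume_graph_eq_zero hu)
  refine ⟨hw.1, ?_⟩
  show w 1 = (1 - w 0) / w 0
  rw [eq_div_iff (ne_of_gt hw.1)]
  exact hw.2

/-- The graph of a `ℚ`-semialgebraic function of `s` (over all of `ℝ`) is null in `ℝ²`. [folklore] -/
theorem cellAlg_null_graph {u : ℝ → ℝ} (hu : IsSemialgebraicFunOn ℚ (univ : Set (Fin 1 → ℝ)) fun x => u (x 0)) :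
    volume {w : Fin 2 → ℝ | w 1 = u (w 0)} = 0 := by
  refine measure_mono_null (fun w hw => ?_) (KZ.volume_graph_eq_zero hu)
  exact ⟨mem_univ _, hw⟩

/-- The graphs `{v = M(s)}` and `{v = U(s)}` are null. [folklore] -/
theorem cellAlg_null_MU (hz : IsAlgebraic ℚ z) :
    volume {w : Fin 2 → ℝ | w 1 = Complex.normSq z * w 0 * (1 - w 0)} = 0 ∧
    volume {w : Fin 2 → ℝ | w 1 = 1 + (Complex.normSq z - 2 * z.re) * w 0} = 0 := by
  obtain ⟨hre, him⟩ := isAlgebraic_re_im hz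
  have hU : IsSemialgebraic ℚ (univ : Set (Fin 1 → ℝ)) := isSemialgebraic_univ
  have hN : IsAlgebraic ℚ (Complex.normSq z) := by
    rw [Complex.normSq_apply]; exact (hre.mul hre).add (him.mul him)
  have hc : IsAlgebraic ℚ (Complex.normSq z - 2 * z.re) := by
    rw [two_mul]; exact hN.sub (hre.add hre)
  have h0 : IsSemialgebraicFunOn ℚ (univ : Set (Fin 1 → ℝ)) (fun x => x 0) :=
    (isSemialgebraicFunOn_aeval hU (X 0)).congr fun w _ => by simp
  have h1 : IsSemialgebraicFunOn ℚ (univ : Set (Fin 1 → ℝ)) (fun x => 1 - x 0) :=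
    (isSemialgebraicFunOn_aeval hU (1 - X 0)).congr fun w _ => by simp
  have hone : IsSemialgebraicFunOn ℚ (univ : Set (Fin 1 → ℝ)) (fun _ => (1 : ℝ)) := by
    simpa using isSemialgebraicFunOn_natCast (k := ℚ) (R := ℝ) hU 1
  constructor
  · exact cellAlg_null_graph (u := fun s => Complex.normSq z * s * (1 - s))
      (IsSemialgebraicFunOn.mul_holds (IsSemialgebraicFunOn.mul_holds
        (isSemialgebraicFunOn_const_of_isAlgebraic hU hN) h0) h1)
  · exact cellAlg_null_graph (u := fun s => 1 + (Complex.normSq z - 2 * z.re) * s)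
      (IsSemialgebraicFunOn.add_holds hone (IsSemialgebraicFunOn.mul_holds
        (isSemialgebraicFunOn_const_of_isAlgebraic hU hc) h0))

/-- `[r] − [r|P₁] − [r|P₂] ∈ relations` for disjoint `ℚ`-semialgebraic `Pᵢ ⊆ dom r` covering it up to a null set
(drop the null remainder, then one domain-additivity move). [cite: KontsevichZagier2001, §1.2 rule (1)] -/
theorem cellAlg_split2 (r : KZ.IntegralRep 2) {P₁ P₂ : Set (Fin 2 → ℝ)}
    (h₁ : IsSemialgebraic ℚ P₁) (h₂ : IsSemialgebraic ℚ P₂) (hs₁ : P₁ ⊆ r.domain) (hs₂ : P₂ ⊆ r.domain)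
    (h12 : Disjoint P₁ P₂) (hcov : volume (r.domain \ (P₁ ∪ P₂)) = 0) :
    KZ.of r - KZ.of (r.restrict P₁ h₁ hs₁) - KZ.of (r.restrict P₂ h₂ hs₂) ∈ KZ.relations := by
  have hU : IsSemialgebraic ℚ (P₁ ∪ P₂) := h₁.union h₂
  have e1 := r.of_sub_of_restrict_mem_relations hU (union_subset hs₁ hs₂) hcov
  have e2 : KZ.of (r.restrict (P₁ ∪ P₂) hU (union_subset hs₁ hs₂)) - KZ.of (r.restrict P₁ h₁ hs₁) -
      KZ.of (r.restrict P₂ h₂ hs₂) ∈ KZ.relations :=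
    KZ.domainAddRel_subset_relations ⟨2, r.restrict (P₁ ∪ P₂) hU (union_subset hs₁ hs₂),
      r.restrict P₁ h₁ hs₁, r.restrict P₂ h₂ hs₂, rfl, by
        rw [show (r.restrict P₁ h₁ hs₁).domain ∩ (r.restrict P₂ h₂ hs₂).domain = P₁ ∩ P₂ from rfl,
          h12.inter_eq, measure_empty],
      fun _ _ => rfl, fun _ _ => rfl, rfl⟩
  have : KZ.of r - KZ.of (r.restrict P₁ h₁ hs₁) - KZ.of (r.restrict P₂ h₂ hs₂) =
      (KZ.of r - KZ.of (r.restrict (P₁ ∪ P₂) hU (union_subset hs₁ hs₂))) +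
      (KZ.of (r.restrict (P₁ ∪ P₂) hU (union_subset hs₁ hs₂)) - KZ.of (r.restrict P₁ h₁ hs₁) -
        KZ.of (r.restrict P₂ h₂ hs₂)) := by abel
  rw [this]
  exact add_mem e1 e2

/-- Three-piece version of `cellAlg_split2`. [cite: KontsevichZagier2001, §1.2 rule (1)] -/
theorem cellAlg_split3 (r : KZ.IntegralRep 2) {P₁ P₂ P₃ : Set (Fin 2 → ℝ)}
    (h₁ : IsSemialgebraic ℚ P₁) (h₂ : IsSemialgebraic ℚ P₂) (h₃ : IsSemialgebraic ℚ P₃)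
    (hs₁ : P₁ ⊆ r.domain) (hs₂ : P₂ ⊆ r.domain) (hs₃ : P₃ ⊆ r.domain)
    (h12 : Disjoint P₁ P₂) (h13 : Disjoint P₁ P₃) (h23 : Disjoint P₂ P₃)
    (hcov : volume (r.domain \ (P₁ ∪ P₂ ∪ P₃)) = 0) :
    KZ.of r - KZ.of (r.restrict P₁ h₁ hs₁) - KZ.of (r.restrict P₂ h₂ hs₂) - KZ.of (r.restrict P₃ h₃ hs₃) ∈
      KZ.relations := by
  have h23sa : IsSemialgebraic ℚ (P₂ ∪ P₃) := h₂.union h₃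
  have e1 := cellAlg_split2 r h₁ h23sa hs₁ (union_subset hs₂ hs₃)
    (Disjoint.union_right h12 h13) (by rwa [← union_assoc])
  have e2 := cellAlg_split2 (r.restrict (P₂ ∪ P₃) h23sa (union_subset hs₂ hs₃)) h₂ h₃
    subset_union_left subset_union_right h23
    (by simp only [KZ.IntegralRep.domain_restrict, sdiff_self, measure_empty])
  have : KZ.of r - KZ.of (r.restrict P₁ h₁ hs₁) - KZ.of (r.restrict P₂ h₂ hs₂) -
      KZ.of (r.restrict P₃ h₃ hs₃) =
      (KZ.of r - KZ.of (r.restrict P₁ h₁ hs₁) - KZ.of (r.restrict (P₂ ∪ P₃) h23sa (union_subset hs₂ hs₃))) +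
      (KZ.of (r.restrict (P₂ ∪ P₃) h23sa (union_subset hs₂ hs₃)) -
        KZ.of ((r.restrict (P₂ ∪ P₃) h23sa (union_subset hs₂ hs₃)).restrict P₂ h₂ subset_union_left) -
        KZ.of ((r.restrict (P₂ ∪ P₃) h23sa (union_subset hs₂ hs₃)).restrict P₃ h₃ subset_union_right)) := by
    have r2 : (r.restrict (P₂ ∪ P₃) h23sa (union_subset hs₂ hs₃)).restrict P₂ h₂ subset_union_left =
        r.restrict P₂ h₂ hs₂ := rfl
    have r3 : (r.restrict (P₂ ∪ P₃) h23sa (union_subset hs₂ hs₃)).restrict P₃ h₃ subset_union_right =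
        r.restrict P₃ h₃ hs₃ := rfl
    rw [r2, r3]
    abel
  rw [this]
  exact add_mem e1 e2


/-- **The log-cell algebra, explicit form.** [cite: KontsevichZagier2001, §1.2 rule (1)] -/
theorem cellAlgebra_core (hz : IsAlgebraic ℚ z) (him : 0 < z.im) (V R : KZ.IntegralRep 2)
    (hV : V.domain = {w | 0 < w 0 ∧ w 0 < 1 ∧ Complex.normSq z * w 0 * (1 - w 0) < w 1 ∧
      w 1 < 1 + (Complex.normSq z - 2 * z.re) * w 0})
    (hVi : EqOn V.integrand (fun w => z.im / (2 * ((1 - w 0 * z.re) ^ 2 + (w 0 * z.im) ^ 2) * w 1)) V.domain)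
    (hR : R.domain = {w | 0 < w 0 ∧ w 0 < 1 ∧ ((Complex.normSq z * w 0 * (1 - w 0) < w 1 ∧ w 1 * w 0 < 1 - w 0) ∨
      (1 - w 0 < w 1 * w 0 ∧ w 1 < Complex.normSq z * w 0 * (1 - w 0)))})
    (hRi : EqOn R.integrand (fun w => (if w 1 * w 0 < 1 - w 0 then (1 : ℝ) else -1) * z.im /
      (2 * ((1 - w 0 * z.re) ^ 2 + (w 0 * z.im) ^ 2) * w 1)) R.domain) :
    (∃ C : KZ.IntegralRep 2, C.domain = {w | 0 < w 0 ∧ w 0 < 1 ∧ ((1 - w 0 < w 1 * w 0 ∧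
        w 1 < 1 + (Complex.normSq z - 2 * z.re) * w 0) ∨ (1 + (Complex.normSq z - 2 * z.re) * w 0 < w 1 ∧
        w 1 * w 0 < 1 - w 0))} ∧
      EqOn C.integrand (fun w => (if w 1 < 1 + (Complex.normSq z - 2 * z.re) * w 0 then (1 : ℝ) else -1) *
        z.im / (2 * ((1 - w 0 * z.re) ^ 2 + (w 0 * z.im) ^ 2) * w 1)) C.domain) ∧
    ∀ C : KZ.IntegralRep 2, C.domain = {w | 0 < w 0 ∧ w 0 < 1 ∧ ((1 - w 0 < w 1 * w 0 ∧
        w 1 < 1 + (Complex.normSq z - 2 * z.re) * w 0) ∨ (1 + (Complex.normSq z - 2 * z.re) * w 0 < w 1 ∧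
        w 1 * w 0 < 1 - w 0))} →
      EqOn C.integrand (fun w => (if w 1 < 1 + (Complex.normSq z - 2 * z.re) * w 0 then (1 : ℝ) else -1) *
        z.im / (2 * ((1 - w 0 * z.re) ^ 2 + (w 0 * z.im) ^ 2) * w 1)) C.domain →
      KZ.of V - KZ.of R - KZ.of C ∈ KZ.relations := by
  set N := Complex.normSq z with hN
  set c := Complex.normSq z - 2 * z.re with hc
  set f : (Fin 2 → ℝ) → ℝ := fun w => z.im / (2 * ((1 - w 0 * z.re) ^ 2 + (w 0 * z.im) ^ 2) * w 1)
    with hf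
  set Cdom : Set (Fin 2 → ℝ) := {w | 0 < w 0 ∧ w 0 < 1 ∧ ((1 - w 0 < w 1 * w 0 ∧ w 1 < 1 + c * w 0) ∨
    (1 + c * w 0 < w 1 ∧ w 1 * w 0 < 1 - w 0))} with hCdom
  set gC : (Fin 2 → ℝ) → ℝ := fun w => (if w 1 < 1 + c * w 0 then (1 : ℝ) else -1) * z.im /
    (2 * ((1 - w 0 * z.re) ^ 2 + (w 0 * z.im) ^ 2) * w 1) with hgC
  set P₁ : Set (Fin 2 → ℝ) := {w | 0 < w 0 ∧ w 0 < 1 ∧ N * w 0 * (1 - w 0) < w 1 ∧ w 1 * w 0 < 1 - w 0 ∧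
    w 1 < 1 + c * w 0} with hP₁
  set P₂ : Set (Fin 2 → ℝ) := {w | 0 < w 0 ∧ w 0 < 1 ∧ N * w 0 * (1 - w 0) < w 1 ∧ 1 - w 0 < w 1 * w 0 ∧
    w 1 < 1 + c * w 0} with hP₂
  set P₃ : Set (Fin 2 → ℝ) := {w | 0 < w 0 ∧ w 0 < 1 ∧ 1 + c * w 0 < w 1 ∧ w 1 * w 0 < 1 - w 0} with hP₃
  set P₄ : Set (Fin 2 → ℝ) := {w | 0 < w 0 ∧ w 0 < 1 ∧ 1 - w 0 < w 1 * w 0 ∧ w 1 < N * w 0 * (1 - w 0)}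
    with hP₄
  have hQ : ∀ w : Fin 2 → ℝ, 0 < (1 - w 0 * z.re) ^ 2 + (w 0 * z.im) ^ 2 := fun w =>
    KZ.rayDilog_den_pos him.ne' z.re (w 0)
  have hUM : ∀ w : Fin 2 → ℝ, N * w 0 * (1 - w 0) < 1 + c * w 0 := fun w => by
    have h : 1 + (Complex.normSq z - 2 * z.re) * w 0 - Complex.normSq z * w 0 * (1 - w 0) =
        (1 - w 0 * z.re) ^ 2 + (w 0 * z.im) ^ 2 := by rw [Complex.normSq_apply]; ring
    have := hQ w
    rw [hN, hc]; linarith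
  have hM0 : ∀ w : Fin 2 → ℝ, 0 < w 0 → w 0 < 1 → 0 < N * w 0 * (1 - w 0) := fun w h0 h1 =>
    mul_pos (mul_pos (Complex.normSq_pos.2 (by rintro rfl; simp at him)) h0) (by linarith)
  obtain ⟨s0, s1, sL, sL', sM, sM', sU, sU'⟩ := cellAlg_sa_basic hz
  have hP₁sa : IsSemialgebraic ℚ P₁ := s0.inter (s1.inter (sM.inter (sL.inter sU)))
  have hP₂sa : IsSemialgebraic ℚ P₂ := s0.inter (s1.inter (sM.inter (sL'.inter sU)))
  have hP₃sa : IsSemialgebraic ℚ P₃ := s0.inter (s1.inter (sU'.inter sL))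
  have hP₄sa : IsSemialgebraic ℚ P₄ := s0.inter (s1.inter (sL'.inter sM'))
  have hCsa : IsSemialgebraic ℚ Cdom := s0.inter (s1.inter ((sL'.inter sU).union (sU'.inter sL)))
  have hP₁V : P₁ ⊆ V.domain := by rw [hV]; exact fun w hw => ⟨hw.1, hw.2.1, hw.2.2.1, hw.2.2.2.2⟩
  have hP₂V : P₂ ⊆ V.domain := by rw [hV]; exact fun w hw => ⟨hw.1, hw.2.1, hw.2.2.1, hw.2.2.2.2⟩
  have hP₁R : P₁ ⊆ R.domain := by rw [hR]; exact fun w hw => ⟨hw.1, hw.2.1, Or.inl ⟨hw.2.2.1, hw.2.2.2.1⟩⟩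
  have hP₃R : P₃ ⊆ R.domain := by
    rw [hR]; exact fun w hw => ⟨hw.1, hw.2.1, Or.inl ⟨(hUM w).trans hw.2.2.1, hw.2.2.2⟩⟩
  have hP₄R : P₄ ⊆ R.domain := by rw [hR]; exact fun w hw => ⟨hw.1, hw.2.1, Or.inr ⟨hw.2.2.1, hw.2.2.2⟩⟩
  have hP₂C : P₂ ⊆ Cdom := fun w hw => ⟨hw.1, hw.2.1, Or.inl ⟨hw.2.2.2.1, hw.2.2.2.2⟩⟩
  have hP₄C : P₄ ⊆ Cdom := fun w hw => ⟨hw.1, hw.2.1, Or.inl ⟨hw.2.2.1, hw.2.2.2.trans (hUM w)⟩⟩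
  have hP₃C : P₃ ⊆ Cdom := fun w hw => ⟨hw.1, hw.2.1, Or.inr ⟨hw.2.2.1, hw.2.2.2⟩⟩
  have d12 : Disjoint P₁ P₂ := disjoint_left.2 fun w h1 h2 => lt_asymm h1.2.2.2.1 h2.2.2.2.1
  have d13 : Disjoint P₁ P₃ := disjoint_left.2 fun w h1 h2 => lt_asymm h1.2.2.2.2 h2.2.2.1
  have d14 : Disjoint P₁ P₄ := disjoint_left.2 fun w h1 h2 => lt_asymm h1.2.2.2.1 h2.2.2.1
  have d34 : Disjoint P₃ P₄ := disjoint_left.2 fun w h1 h2 => lt_asymm h1.2.2.2 h2.2.2.1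
  have d24 : Disjoint P₂ P₄ := disjoint_left.2 fun w h1 h2 => lt_asymm h1.2.2.1 h2.2.2.2
  have d23 : Disjoint P₂ P₃ := disjoint_left.2 fun w h1 h2 => lt_asymm h1.2.2.2.1 h2.2.2.2
  -- the three domains are covered up to null graphs
  obtain ⟨nullM, nullU⟩ := cellAlg_null_MU hz
  have covV : volume (V.domain \ (P₁ ∪ P₂)) = 0 := by
    refine measure_mono_null (fun w hw => ?_) cellAlg_null_L
    obtain ⟨hwV, hwn⟩ := hw
    rw [hV] at hwV
    obtain ⟨h0, h1, hM, hU⟩ := hwV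
    simp only [mem_union, not_or] at hwn
    refine ⟨h0, ?_⟩
    by_contra hne
    rcases lt_or_gt_of_ne hne with hlt | hgt
    · exact hwn.1 ⟨h0, h1, hM, hlt, hU⟩
    · exact hwn.2 ⟨h0, h1, hM, hgt, hU⟩
  have covR : volume (R.domain \ (P₁ ∪ P₃ ∪ P₄)) = 0 := by
    refine measure_mono_null (fun w hw => ?_) nullU
    obtain ⟨hwR, hwn⟩ := hw
    rw [hR] at hwR
    obtain ⟨h0, h1, hA | hB⟩ := hwR
    · simp only [mem_union, not_or] at hwn
      show w 1 = 1 + c * w 0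
      by_contra hne
      rcases lt_or_gt_of_ne hne with hlt | hgt
      · exact hwn.1.1 ⟨h0, h1, hA.1, hA.2, hlt⟩
      · exact hwn.1.2 ⟨h0, h1, hgt, hA.2⟩
    · exact absurd (Or.inr ⟨h0, h1, hB.1, hB.2⟩ : w ∈ P₁ ∪ P₃ ∪ P₄) hwn
  have covC : volume (Cdom \ (P₂ ∪ P₄ ∪ P₃)) = 0 := by
    refine measure_mono_null (fun w hw => ?_) nullM
    obtain ⟨⟨h0, h1, hA | hB⟩, hwn⟩ := hw
    · simp only [mem_union, not_or] at hwn
      show w 1 = N * w 0 * (1 - w 0)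
      by_contra hne
      rcases lt_or_gt_of_ne hne with hlt | hgt
      · exact hwn.1.2 ⟨h0, h1, hA.1, hlt⟩
      · exact hwn.1.1 ⟨h0, h1, hgt, hA.1, hA.2⟩
    · exact absurd (Or.inr ⟨h0, h1, hB.1, hB.2⟩ : w ∈ P₂ ∪ P₄ ∪ P₃) hwn
  -- the integrands on the cells
  have hfV : ∀ w ∈ V.domain, V.integrand w = f w := fun w hw => hVi hw
  have hfRpos : ∀ w ∈ R.domain, w 1 * w 0 < 1 - w 0 → R.integrand w = f w := fun w hw h => by
    rw [hRi hw]; simp only [if_pos h, one_mul, hf]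
  have hfRneg : ∀ w ∈ R.domain, 1 - w 0 < w 1 * w 0 → R.integrand w = -f w := fun w hw h => by
    rw [hRi hw]; simp only [if_neg (lt_asymm h), hf, neg_one_mul, neg_div]
  -- integrability of `f` on the cells of `C`, and the existence of a `C`-representation
  have hmeas : ∀ {P : Set (Fin 2 → ℝ)}, IsSemialgebraic ℚ P → MeasurableSet P := fun h =>
    IsSemialgebraic.measurableSet_holds h
  have iP₂ : IntegrableOn gC P₂ :=
    ((V.integrableOn.mono_set hP₂V).congr_fun (fun w hw => hfV w (hP₂V hw)) (hmeas hP₂sa)).congr_fun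
      (fun w hw => by simp only [hgC, if_pos hw.2.2.2.2, one_mul, hf]) (hmeas hP₂sa)
  have iP₄ : IntegrableOn gC P₄ :=
    (((R.integrableOn.mono_set hP₄R).congr_fun (fun w hw => hfRneg w (hP₄R hw) hw.2.2.1)
      (hmeas hP₄sa)).neg).congr_fun (fun w hw => by
        simp only [Pi.neg_apply, neg_neg, hgC, if_pos (hw.2.2.2.trans (hUM w)), one_mul, hf])
      (hmeas hP₄sa)
  have iP₃ : IntegrableOn gC P₃ :=
    (((R.integrableOn.mono_set hP₃R).congr_fun (fun w hw => hfRpos w (hP₃R hw) hw.2.2.2)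
      (hmeas hP₃sa)).neg).congr_fun (fun w hw => by
        simp only [Pi.neg_apply, hgC, if_neg (lt_asymm hw.2.2.1), neg_one_mul, neg_div, hf])
      (hmeas hP₃sa)
  have iC : IntegrableOn gC Cdom := by
    refine ((iP₂.union iP₄).union iP₃).congr_set_ae (ae_eq_set.2 ⟨covC, ?_⟩)
    rw [sdiff_eq_empty.2 (union_subset (union_subset hP₂C hP₄C) hP₃C), measure_empty]
  have hgCsa : IsSemialgebraicFunOn ℚ Cdom gC := by
    have h0f : IsSemialgebraicFunOn ℚ Cdom (fun w => w 0) :=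
      (isSemialgebraicFunOn_aeval hCsa (X 0)).congr fun w _ => by simp
    have h1f : IsSemialgebraicFunOn ℚ Cdom (fun w => w 1) :=
      (isSemialgebraicFunOn_aeval hCsa (X 1)).congr fun w _ => by simp
    have hpos : ∀ w ∈ Cdom, 0 < w 1 := by
      rintro w ⟨h0, h1, hA | hB⟩
      · by_contra hle
        push Not at hle
        have : w 1 * w 0 ≤ 0 := mul_nonpos_of_nonpos_of_nonneg hle h0.le
        linarith [hA.1]
      · linarith [hB.1, hUM w, hM0 w h0 h1]
    have hden : IsSemialgebraicFunOn ℚ Cdom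
        (fun w => 2 * ((1 - w 0 * z.re) ^ 2 + (w 0 * z.im) ^ 2) * w 1) := by
      obtain ⟨hre, him'⟩ := isAlgebraic_re_im hz
      have ha := isSemialgebraicFunOn_const_of_isAlgebraic hCsa hre
      have hb := isSemialgebraicFunOn_const_of_isAlgebraic hCsa him'
      have h2 : IsSemialgebraicFunOn ℚ Cdom (fun _ => (2 : ℝ)) := by
        simpa using isSemialgebraicFunOn_natCast (k := ℚ) (R := ℝ) hCsa 2
      have hone : IsSemialgebraicFunOn ℚ Cdom (fun _ => (1 : ℝ)) := by
        simpa using isSemialgebraicFunOn_natCast (k := ℚ) (R := ℝ) hCsa 1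
      have hq1 := IsSemialgebraicFunOn.sub_holds hone (IsSemialgebraicFunOn.mul_holds h0f ha)
      have hq2 := IsSemialgebraicFunOn.mul_holds h0f hb
      have hQ' := IsSemialgebraicFunOn.add_holds (IsSemialgebraicFunOn.mul_holds hq1 hq1)
        (IsSemialgebraicFunOn.mul_holds hq2 hq2)
      exact (IsSemialgebraicFunOn.mul_holds (IsSemialgebraicFunOn.mul_holds h2 hQ') h1f).congr
        fun w _ => by simp only [Pi.mul_apply, Pi.add_apply, Pi.sub_apply]; ring
    have hfsa : IsSemialgebraicFunOn ℚ Cdom f :=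
      (IsSemialgebraicFunOn.div (isSemialgebraicFunOn_const_of_isAlgebraic hCsa
        (isAlgebraic_re_im hz).2) hden fun w hw => by
          have := hQ w; have := hpos w hw; positivity).congr fun w _ => by simp [hf]
    have hA : IsSemialgebraic ℚ (Cdom ∩ {w | w 1 < 1 + (Complex.normSq z - 2 * z.re) * w 0}) := hCsa.inter sU
    have hB : IsSemialgebraic ℚ (Cdom \ {w | w 1 < 1 + (Complex.normSq z - 2 * z.re) * w 0}) := hCsa.diff sU
    have h := IsSemialgebraicFunOn.union (hfsa.mono inter_subset_left hA) ((hfsa.mono sdiff_subset hB).neg)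
      (F := gC) (fun w hw => by
        have hw' : w 1 < 1 + c * w 0 := hw.2
        simp only [hgC, if_pos hw', one_mul, hf])
      (fun w hw => by
        have hw' : ¬ (w 1 < 1 + c * w 0) := hw.2
        simp only [hgC, if_neg hw', neg_one_mul, neg_div, hf, Pi.neg_apply])
    rwa [inter_union_sdiff] at h
  refine ⟨⟨⟨Cdom, gC, hCsa, hgCsa, iC⟩, rfl, fun _ _ => rfl⟩, fun C hCd hCi => ?_⟩
  -- the given `C`: splits and congruences
  have hP₂C' : P₂ ⊆ C.domain := hCd ▸ hP₂C
  have hP₄C' : P₄ ⊆ C.domain := hCd ▸ hP₄C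
  have hP₃C' : P₃ ⊆ C.domain := hCd ▸ hP₃C
  have hfCpos : ∀ w ∈ C.domain, w 1 < 1 + c * w 0 → C.integrand w = f w := fun w hw h => by
    rw [hCi hw]; simp only [hgC, if_pos h, one_mul, hf]
  have hfCneg : ∀ w ∈ C.domain, 1 + c * w 0 < w 1 → C.integrand w = -f w := fun w hw h => by
    rw [hCi hw]; simp only [hgC, if_neg (lt_asymm h), hf, neg_one_mul, neg_div]
  have eV := cellAlg_split2 V hP₁sa hP₂sa hP₁V hP₂V d12 covV
  have eR := cellAlg_split3 R hP₁sa hP₃sa hP₄sa hP₁R hP₃R hP₄R d13 d14 d34 covR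
  have eC := cellAlg_split3 C hP₂sa hP₄sa hP₃sa hP₂C' hP₄C' hP₃C' d24 d23 d34.symm (by rw [hCd]; exact covC)
  have g1 : KZ.of (V.restrict P₁ hP₁sa hP₁V) - KZ.of (R.restrict P₁ hP₁sa hP₁R) ∈ KZ.relations :=
    KZ.of_sub_of_mem_relations_of_eqOn (r := V.restrict P₁ hP₁sa hP₁V)
      (r' := R.restrict P₁ hP₁sa hP₁R) rfl fun w hw => by
      show V.integrand w = R.integrand w
      rw [hfV w (hP₁V hw), hfRpos w (hP₁R hw) hw.2.2.2.1]
  have g2 : KZ.of (V.restrict P₂ hP₂sa hP₂V) - KZ.of (C.restrict P₂ hP₂sa hP₂C') ∈ KZ.relations :=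
    KZ.of_sub_of_mem_relations_of_eqOn (r := V.restrict P₂ hP₂sa hP₂V)
      (r' := C.restrict P₂ hP₂sa hP₂C') rfl fun w hw => by
      show V.integrand w = C.integrand w
      rw [hfV w (hP₂V hw), hfCpos w (hP₂C' hw) hw.2.2.2.2]
  have g3 : KZ.of (R.restrict P₄ hP₄sa hP₄R) + KZ.of (C.restrict P₄ hP₄sa hP₄C') ∈ KZ.relations :=
    KZ.of_add_of_mem_relations_of_eqOn_neg (r := R.restrict P₄ hP₄sa hP₄R)
      (r' := C.restrict P₄ hP₄sa hP₄C') rfl fun w hw => by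
      show C.integrand w = -R.integrand w
      rw [hfCpos w (hP₄C' hw) (hw.2.2.2.trans (hUM w)), hfRneg w (hP₄R hw) hw.2.2.1, neg_neg]
  have g4 : KZ.of (R.restrict P₃ hP₃sa hP₃R) + KZ.of (C.restrict P₃ hP₃sa hP₃C') ∈ KZ.relations :=
    KZ.of_add_of_mem_relations_of_eqOn_neg (r := R.restrict P₃ hP₃sa hP₃R)
      (r' := C.restrict P₃ hP₃sa hP₃C') rfl fun w hw => by
      show C.integrand w = -R.integrand w
      rw [hfCneg w (hP₃C' hw) hw.2.2.1, hfRpos w (hP₃R hw) hw.2.2.2]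
  have key : KZ.of V - KZ.of R - KZ.of C =
      (KZ.of V - KZ.of (V.restrict P₁ hP₁sa hP₁V) - KZ.of (V.restrict P₂ hP₂sa hP₂V)) -
      (KZ.of R - KZ.of (R.restrict P₁ hP₁sa hP₁R) - KZ.of (R.restrict P₃ hP₃sa hP₃R) -
        KZ.of (R.restrict P₄ hP₄sa hP₄R)) -
      (KZ.of C - KZ.of (C.restrict P₂ hP₂sa hP₂C') - KZ.of (C.restrict P₄ hP₄sa hP₄C') -
        KZ.of (C.restrict P₃ hP₃sa hP₃C')) +
      (KZ.of (V.restrict P₁ hP₁sa hP₁V) - KZ.of (R.restrict P₁ hP₁sa hP₁R)) +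
      (KZ.of (V.restrict P₂ hP₂sa hP₂V) - KZ.of (C.restrict P₂ hP₂sa hP₂C')) -
      (KZ.of (R.restrict P₄ hP₄sa hP₄R) + KZ.of (C.restrict P₄ hP₄sa hP₄C')) -
      (KZ.of (R.restrict P₃ hP₃sa hP₃R) + KZ.of (C.restrict P₃ hP₃sa hP₃C')) := by abel
  rw [key]
  exact sub_mem (sub_mem (add_mem (add_mem (sub_mem (sub_mem eV eR) eC) g1) g2) g3) g4

/-- **STUB `stub_cellAlgebra`** (log-cell algebra, rules 1a/1b): `[V] − [R'] − [C] ∈ relations` and a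
`C`-representation exists (`cellAlgebra_core`). [cite: KontsevichZagier2001, §1.2 rule (1)] -/
theorem stub_cellAlgebra : ∀ z : ℂ, IsAlgebraic ℚ z → 0 < z.im → ∀ V : Literature.NumberTheory.Transcendental.KZ.IntegralRep 2, V.domain = {w | 0 < w 0 ∧ w 0 < 1 ∧ Complex.normSq z * w 0 * (1 - w 0) < w 1 ∧ w 1 < 1 + (Complex.normSq z - 2 * z.re) * w 0} → Set.EqOn V.integrand (fun w => z.im / (2 * ((1 - w 0 * z.re) ^ 2 + (w 0 * z.im) ^ 2) * w 1)) V.domain → ∀ R : Literature.NumberTheory.Transcendental.KZ.IntegralRep 2, R.domain = {w | 0 < w 0 ∧ w 0 < 1 ∧ ((Complex.normSq z * w 0 * (1 - w 0) < w 1 ∧ w 1 * w 0 < 1 - w 0) ∨ (1 - w 0 < w 1 * w 0 ∧ w 1 < Complex.normSq z * w 0 * (1 - w 0)))} → Set.EqOn R.integrand (fun w => (if w 1 * w 0 < 1 - w 0 then (1 : ℝ) else -1) * z.im / (2 * ((1 - w 0 * z.re) ^ 2 + (w 0 * z.im) ^ 2) * w 1)) R.domain → (∃ C : Literature.NumberTheory.Transcendental.KZ.IntegralRep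 2, C.domain = {w | 0 < w 0 ∧ w 0 < 1 ∧ ((1 - w 0 < w 1 * w 0 ∧ w 1 < 1 + (Complex.normSq z - 2 * z.re) * w 0) ∨ (1 + (Complex.normSq z - 2 * z.re) * w 0 < w 1 ∧ w 1 * w 0 < 1 - w 0))} ∧ Set.EqOn C.integrand (fun w => (if w 1 < 1 + (Complex.normSq z - 2 * z.re) * w 0 then (1 : ℝ) else -1) * z.im / (2 * ((1 - w 0 * z.re) ^ 2 + (w 0 * z.im) ^ 2) * w 1)) C.domain) ∧ (∀ C : Literature.NumberTheory.Transcendental.KZ.IntegralRep 2, C.domain = {w | 0 < w 0 ∧ w 0 < 1 ∧ ((1 - w 0 < w 1 * w 0 ∧ w 1 < 1 + (Complex.normSq z - 2 * z.re) * w 0) ∨ (1 + (Complex.normSq z - 2 * z.re) * w 0 < w 1 ∧ w 1 * w 0 < 1 - w 0))} → Set.EqOn C.integrand (fun w => (if w 1 < 1 + (Complex.normSq z - 2 * z.re) * w 0 then (1 : ℝ) else -1) * z.im / (2 * ((1 - w 0 * z.re) ^ 2 + (w 0 * z.im) ^ 2) * w 1)) C.domain → Literature.NumberTheory.Transcendental.KZ.of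 V - Literature.NumberTheory.Transcendental.KZ.of R - Literature.NumberTheory.Transcendental.KZ.of C ∈ Literature.NumberTheory.Transcendental.KZ.relations) :=
  fun _ hz him V hV hVi R hR hRi => cellAlgebra_core hz him V R hV hVi hR hRi

end Summit.KontsevichZagierPeriods.HyperbolicBloch.OffTetraSectorKernel

end
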